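import Summits.AtomisticToContinuum.Crystallization.Theorems.OverbindingBudgetEnergyStraightening
import Summits.AtomisticToContinuum.Crystallization.Theorems.ChartedPlanarOrderStackedUniform

/-!
# OverbindingBudget · decomp-a2c lens-4 g34 — part XXII-G: the height band GEO is PROVED

Helper file under `--supports stmt-AtomisticToContinuum-31280` (RDEF = `Theses.OverbindingBudget.RobustDefectLimitWindows`); closes nothing.

The piece GEO `StackedHeights Λ₁ η₁ η₂` of part XXII-F (gap heights of an admissible stacked configuration lie in `[η₁, η₂]`) is PROVED at
`Λ₁ ≤ 17/16` with the band `[3/8, 23/20]` (`stackedHeights_holds`), from lens-3's `ChartedPlanarOrderStackedUniform.stackedUniform` (clean-P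
two-shell dichotomy: `27/32 ≤ ‖a‖`, T-heights in `[192/425, 404/375]·‖a‖`, S-heights in `[8/17, 24/25]·‖a‖`) and the uniqueness of the unit
normal of an independent in-plane pair up to sign (`unitNormal_eq_or_eq_neg`, finrank bookkeeping in `E3`).
Cones PROVED: XXVIII `rdef_twentyeighth_of_recordK_straight[_ref]` = cones XXVII with GEO discharged — beneath ★ the open energy leaves are
STR `StraightenedFloor (17/16)` [ANALYTIC·M] and NUM-T/NUM-S `StraightCellEnergyT/S (17/16) (3/8) (23/20) box (e⋆ + 2κ′)` [CERT·M, configuration-free].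
-/

noncomputable section

namespace Summit.AtomisticToContinuum.Crystallization.Theorems.OverbindingBudgetEnergyStraighteningHeights

open Metric Module
open scoped RealInnerProductSpace
open Literature.MathematicalPhysics.StatisticalMechanics (lennardJones groundStateEnergy)
open Summit.AtomisticToContinuum.Crystallization.Theses.OverbindingBudget (RobustDefectLimitWindows)
open Summit.AtomisticToContinuum.Crystallization.Theses.PricedLinkCensus (ChargedEnergyGap)
open Summit.AtomisticToContinuum.Crystallization.Theorems.ChargedEnergyGapNegative (eStar)
open Summit.AtomisticToContinuum.Crystallization.Theorems.OverbindingBudgetGradedBareness (CleanlessExcessT)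
open Summit.AtomisticToContinuum.Crystallization.Theorems.OverbindingBudgetCoherentCut (CoherentResidual)
open Summit.AtomisticToContinuum.Crystallization.Theorems.OverbindingBudgetUniformCutStatements (GrossCleanBallsU)
open Summit.AtomisticToContinuum.Crystallization.Theorems.OverbindingBudgetElasticSplitScale (CompressedVirialLaw)
open Summit.AtomisticToContinuum.Crystallization.Theorems.OverbindingBudgetElasticSplitShear (StressFree)
open Summit.AtomisticToContinuum.Crystallization.Theorems.ChartedPlanarOrderChunkFloor (E3)
open Summit.AtomisticToContinuum.Crystallization.Theorems.ChartedPlanarOrderRigidityDoor (IsNash)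
open Summit.AtomisticToContinuum.Crystallization.Theorems.ChartedPlanarOrderDensityDichotomy (μS IsSep)
open Summit.AtomisticToContinuum.Crystallization.Theorems.ChartedPlanarOrderDoorLayered (Layered)
open Summit.AtomisticToContinuum.Crystallization.Theorems.ChartedPlanarOrderProfileSlavingLJ (IsStacked gapStress incr)
open Summit.AtomisticToContinuum.Crystallization.Theorems.ChartedPlanarOrderCleanScaleP (IsCleanP)
open Summit.AtomisticToContinuum.Crystallization.Theorems.ChartedPlanarOrderStackedUniform (stackedUniform)
open Summit.AtomisticToContinuum.Crystallization.Theorems.ChartedPlanarOrderTubeConvex (TubeConvexW' TubeConvexRef)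
open Summit.AtomisticToContinuum.Crystallization.Theorems.OverbindingBudgetScaleWidening (IsCleanW DoorPeriodicW)
open Summit.AtomisticToContinuum.Crystallization.Theorems.OverbindingBudgetTwoShellShape (TwoShellShape BarlowGluingW)
open Summit.AtomisticToContinuum.Crystallization.Theorems.OverbindingBudgetStackedRigidityW (StackedReductionW GapStressVanishesW)
open Summit.AtomisticToContinuum.Crystallization.Theorems.OverbindingBudgetStackedRigidityRef (RegistryPinningW)
open Summit.AtomisticToContinuum.Crystallization.Theorems.OverbindingBudgetRegistryCut (IsUnitNormal Pinned RegistryResidual RegistryTube RegistryMetric)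
open Summit.AtomisticToContinuum.Crystallization.Theorems.OverbindingBudgetRegistrySquare (PinnedSq)
open Summit.AtomisticToContinuum.Crystallization.Theorems.OverbindingBudgetRegistryDichotomy (IsTType IsSType RegistryGeometryW BalancedLocus
  SqRegistryGeometryW SqBalancedHeight SqRegistryMetric)
open Summit.AtomisticToContinuum.Crystallization.Theorems.OverbindingBudgetRegistryDichotomyCW (RegistryMetricCW SqRegistryMetricCW)
open Summit.AtomisticToContinuum.Crystallization.Theorems.OverbindingBudgetEnergyPinning (StackedCellPinningU)
open Summit.AtomisticToContinuum.Crystallization.Theorems.OverbindingBudgetEnergyStraightening (StraightenedFloor StackedHeights StraightCellEnergyT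
  StraightCellEnergyS stackedCellPinningU_of_straight rdef_twentyseventh_of_recordK_straight rdef_twentyseventh_of_recordK_straight_ref)

/-! ## §1 The unit normal of an independent in-plane pair is unique up to sign -/

/-- Two unit normals of a linearly independent pair `a, b` in `E3` agree up to sign. [bookkeeping: `dim (span{a,b})ᗮ = 3 − 2 = 1`] -/
theorem unitNormal_eq_or_eq_neg {a b n ν : E3} (hab : LinearIndependent ℝ ![a, b]) (hn : IsUnitNormal a b n) (hν : IsUnitNormal a b ν) :
    n = ν ∨ n = -ν := by
  obtain ⟨hn1, hna, hnb⟩ := hn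
  obtain ⟨hν1, hνa, hνb⟩ := hν
  set K : Submodule ℝ E3 := Submodule.span ℝ (Set.range ![a, b]) with hK
  have hKf : finrank ℝ K = 2 := by
    rw [hK, finrank_span_eq_card hab, Fintype.card_fin]
  have hKo : finrank ℝ Kᗮ = 1 := by
    have h := Submodule.finrank_add_finrank_orthogonal K
    have h3 : finrank ℝ E3 = 3 := finrank_euclideanSpace_fin
    omega
  have memo : ∀ x : E3, ⟪x, a⟫ = 0 → ⟪x, b⟫ = 0 → x ∈ Kᗮ := by
    intro x hxa hxb
    have hle : K ≤ (ℝ ∙ x)ᗮ := by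
      rw [hK, Submodule.span_le]
      rintro _ ⟨i, rfl⟩
      fin_cases i
      · simpa [Submodule.mem_orthogonal_singleton_iff_inner_right] using hxa
      · simpa [Submodule.mem_orthogonal_singleton_iff_inner_right] using hxb
    exact Submodule.orthogonal_le hle (Submodule.le_orthogonal_orthogonal _ (Submodule.mem_span_singleton_self x))
  have hν0 : (⟨ν, memo ν hνa hνb⟩ : Kᗮ) ≠ 0 := by
    intro h
    have h' : ν = 0 := by simpa using congrArg Subtype.val h
    rw [h', norm_zero] at hν1
    exact zero_ne_one hν1
  obtain ⟨c, hc⟩ := (finrank_eq_one_iff_of_nonzero' _ hν0).1 hKo ⟨n, memo n hna hnb⟩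
  have hc' : c • ν = n := by simpa using congrArg Subtype.val hc
  have habs : |c| = 1 := by
    have := congrArg norm hc'
    rw [norm_smul, Real.norm_eq_abs, hν1, mul_one, hn1] at this
    exact this
  rcases (abs_eq (zero_le_one : (0 : ℝ) ≤ 1)).1 habs with h | h
  · left; rw [← hc', h, one_smul]
  · right; rw [← hc', h, neg_one_smul]

/-! ## §2 GEO PROVED: the height band `[3/8, 23/20]` at `Λ₁ ≤ 17/16` -/

/-- ★ **GEO `StackedHeights Λ₁ (3/8) (23/20)` holds for `Λ₁ ≤ 17/16`**: by `stackedUniform` the gap heights along its unit normal lie in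
`[192/425, 404/375]·‖a‖` (T) or `[8/17, 24/25]·‖a‖` (S) with `27/32 ≤ ‖a‖ ≤ 17/16`, and any unit normal with positive heights IS that normal. [this file] -/
theorem stackedHeights_holds {Λ₁ : ℝ} (hΛ₁ : Λ₁ ≤ 17 / 16) : StackedHeights Λ₁ (3 / 8) (23 / 20) := by
  intro δ hδ a b w hst hab ha hb hs hc hna hf hz n hn hpos m
  have hδ0 : (0 : ℝ) < δ := by linarith
  have hc' : IsCleanP (103 / 100) (μS (Layered a b w)) := hc
  obtain ⟨ν, hν1, hνa, hνb, hνpos, ha0, -, -, hTS⟩ :=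
    stackedUniform (by norm_num : (103 / 100 : ℝ) ≤ 8 / 7) hδ0 hs hc' hst (ha.trans hΛ₁) (hb.trans hΛ₁)
  have key : ∀ k : ℤ, ⟪incr w k, ν⟫ = ⟪ν, w (k - 1 + 1) - w (k - 1)⟫ := by
    intro k
    rw [real_inner_comm, sub_add_cancel]
    rfl
  have hnν : n = ν := by
    rcases unitNormal_eq_or_eq_neg hab hn ⟨hν1, hνa, hνb⟩ with h | h
    · exact h
    · exfalso
      have h1 := hpos 1
      rw [h, inner_neg_right, key 1] at h1
      have h2 := hνpos (1 - 1)
      linarith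
  have ha1 : ‖a‖ ≤ 17 / 16 := ha.trans hΛ₁
  rw [hnν, key m]
  rcases hTS with ⟨-, hw⟩ | ⟨-, hw⟩
  · obtain ⟨h1, h2⟩ := hw (m - 1)
    constructor <;> nlinarith [ha0, ha1]
  · obtain ⟨h1, h2⟩ := hw (m - 1)
    constructor <;> nlinarith [ha0, ha1]

/-- ★ the energy cut through straightening with GEO discharged: STR ∧ NUM-T(e⋆ + 2κ′) ∧ NUM-S(e⋆ + 2κ′) on the band `[3/8, 23/20]` ⇒ ★ `StackedCellPinningU`
(`0 < κ′`, `Λ₁ ≤ 17/16`). [this file] -/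
theorem stackedCellPinningU_of_straight_band {Λ₁ s₁ s₂ t₁ t₂ κ' : ℝ} (hκ' : 0 < κ') (hΛ₁ : Λ₁ ≤ 17 / 16) (hSTR : StraightenedFloor Λ₁)
    (hT : StraightCellEnergyT Λ₁ (3 / 8) (23 / 20) s₁ s₂ (eStar + 2 * κ')) (hS : StraightCellEnergyS Λ₁ (3 / 8) (23 / 20) t₁ t₂ (eStar + 2 * κ')) :
    StackedCellPinningU Λ₁ s₁ s₂ t₁ t₂ :=
  stackedCellPinningU_of_straight hκ' hΛ₁ hSTR (stackedHeights_holds hΛ₁) hT hS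

/-! ## §3 Cones XXVIII: beneath ★ the open leaves are STR, NUM-T, NUM-S -/

/-- ★ **RDEF cone, TWENTY-EIGHTH form at the numbers of record: ENERGY PINNING through STRAIGHTENING, height band PROVED** (W′ currency): beneath 7d
the open energy leaves are STR `StraightenedFloor (17/16)` [ANALYTIC·M] and NUM-T/NUM-S `StraightCellEnergyT/S (17/16) (3/8) (23/20) box (e⋆ + 2κ′)`
[CERT·M, configuration-free]; boxes SYMBOLIC. [this file] -/
theorem rdef_twentyeighth_of_recordK_straight (s₁ s₂ t₁ t₂ h₀ h₁ κ' : ℝ) (hκ' : 0 < κ') (hG : GrossCleanBallsU (1 / 250) 10)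
    (hCEG : ChargedEnergyGap) (hC : CompressedVirialLaw (1 / 250) 10) (hS : TwoShellShape (1 / 100) (3 / 50) (1 / 450)) (hB₂ : BarlowGluingW)
    (hD : DoorPeriodicW 2) (hSR : StackedReductionW 2 (17 / 16)) (hV : GapStressVanishesW (17 / 16))
    (hP : RegistryPinningW (17 / 16) (1 / 40) (3 / 16)) (hT : TubeConvexW' (17 / 16) (1 / 40)) (hSTR : StraightenedFloor (17 / 16))
    (hNT : StraightCellEnergyT (17 / 16) (3 / 8) (23 / 20) s₁ s₂ (eStar + 2 * κ'))
    (hNS : StraightCellEnergyS (17 / 16) (3 / 8) (23 / 20) t₁ t₂ (eStar + 2 * κ')) (hGeo : RegistryGeometryW (17 / 16) s₁ s₂ h₀ (3 / 20))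
    (hBal : BalancedLocus s₁ s₂ h₀ (1 / 40)) (hR1 : RegistryResidual s₁ s₂ (1 / 250)) (hR2 : RegistryTube s₁ s₂ (1 / 100) 1)
    (hMet : RegistryMetric s₁ s₂ (3 / 500)) (hSqGeo : SqRegistryGeometryW (17 / 16) t₁ t₂ h₁ (3 / 20)) (hSqH : SqBalancedHeight t₁ t₂ h₁ (1 / 100))
    (hSqMet : SqRegistryMetric t₁ t₂ h₁ (1 / 100) 0) (hCE : CleanlessExcessT) (hRes : CoherentResidual 10) : RobustDefectLimitWindows :=
  rdef_twentyseventh_of_recordK_straight s₁ s₂ t₁ t₂ h₀ h₁ (3 / 8) (23 / 20) κ' hκ' hG hCEG hC hS hB₂ hD hSR hV hP hT hSTR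
    (stackedHeights_holds le_rfl) hNT hNS hGeo hBal hR1 hR2 hMet hSqGeo hSqH hSqMet hCE hRes

/-- ★ **RDEF cone, twenty-eighth form at the numbers of record, reference-centred (CURRENCY OF RECORD): ENERGY PINNING through STRAIGHTENING, height
band PROVED.** [this file] -/
theorem rdef_twentyeighth_of_recordK_straight_ref (s₁ s₂ t₁ t₂ h₀ h₁ κ' : ℝ) (hκ' : 0 < κ') (hG : GrossCleanBallsU (1 / 250) 10)
    (hCEG : ChargedEnergyGap) (hC : CompressedVirialLaw (1 / 250) 10) (hS : TwoShellShape (1 / 100) (3 / 50) (1 / 450)) (hB₂ : BarlowGluingW)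
    (hD : DoorPeriodicW 2) (hSR : StackedReductionW 2 (17 / 16)) (hV : GapStressVanishesW (17 / 16))
    (hP : RegistryPinningW (17 / 16) (1 / 40) (3 / 16)) (hT : TubeConvexRef (17 / 16) (1 / 40)) (hSTR : StraightenedFloor (17 / 16))
    (hNT : StraightCellEnergyT (17 / 16) (3 / 8) (23 / 20) s₁ s₂ (eStar + 2 * κ'))
    (hNS : StraightCellEnergyS (17 / 16) (3 / 8) (23 / 20) t₁ t₂ (eStar + 2 * κ')) (hGeo : RegistryGeometryW (17 / 16) s₁ s₂ h₀ (3 / 20))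
    (hBal : BalancedLocus s₁ s₂ h₀ (1 / 40)) (hR1 : RegistryResidual s₁ s₂ (1 / 250)) (hR2 : RegistryTube s₁ s₂ (1 / 100) 1)
    (hMet : RegistryMetricCW s₁ s₂ (3 / 500)) (hSqGeo : SqRegistryGeometryW (17 / 16) t₁ t₂ h₁ (3 / 20))
    (hSqH : SqBalancedHeight t₁ t₂ h₁ (1 / 100)) (hSqMet : SqRegistryMetricCW t₁ t₂ h₁ (1 / 100) 0) (hCE : CleanlessExcessT)
    (hRes : CoherentResidual 10) : RobustDefectLimitWindows :=
  rdef_twentyseventh_of_recordK_straight_ref s₁ s₂ t₁ t₂ h₀ h₁ (3 / 8) (23 / 20) κ' hκ' hG hCEG hC hS hB₂ hD hSR hV hP hT hSTR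
    (stackedHeights_holds le_rfl) hNT hNS hGeo hBal hR1 hR2 hMet hSqGeo hSqH hSqMet hCE hRes

end Summit.AtomisticToContinuum.Crystallization.Theorems.OverbindingBudgetEnergyStraighteningHeights

end
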